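import Literature.Claims.NS.ClayR3BKMBridge
import Literature.Claims.NS.Shlygin2026
import Mathlib.Analysis.Convex.Deriv
import Mathlib.Analysis.SpecialFunctions.Trigonometric.DerivHyp
import HarnessLib

/-!
# Claim skeleton (D-0090 NS-CLAIMS, C159): Washburn 2026 — «Global regularity for the 3D
# incompressible Navier–Stokes equations via the Topological Frustration Pinch»

Typed skeleton of Jonathan Washburn (Recognition Science Research Institute, Austin), *Global
Regularity for the 3D Incompressible Navier–Stokes Equations via the Topological Frustration
Pinch*, Zenodo record 19490305 (concept 19490304, one version, 2026-04-10; file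
«NS-Topological-Frustration-Pinch-Unconditional.pdf», 18 pp., PDF sha16 `5136fd99b8db3211`; PDF page =
printed page = file `pNNN`) = bib `Washburn2026`, text of record of cell `ns-claims` row C159 (census
pin `run/shared/lean/pub/ns-claims/census/texts/Washburn2026/`, README sha16 `bdff9106efc458ba`; line
numbers `l.N` = lines of `pages/pNNN.txt`; lit seat's `sources/Washburn2026/LOCATORS.md` rev 2 sha16
`7179b1e123263367`). UNREFEREED CLAIM under adjudication — NOTHING in this file asserts a step of the
paper: printed statements are `def … : Prop`; the `theorem`s are kernel compositions of the paper's
own implications and the Clay (A) identification through the tree's a priori vorticity door.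
Verdict vocabulary is the refuter's / referee's.

## The claimed statement, as printed (Thm 1.1 p.3 l.2–7)
«Theorem 1.1 (Global regularity). Let u₀ ∈ H¹(R³) be smooth and divergence-free, and let u be the
corresponding smooth solution of (1.1) on its maximal interval of existence [0, T*). Then T* = ∞.»
((1.1) p.2 l.28–49: the unforced system on `ℝ³ × [0, T)` with `ν > 0`.) §10 p.15 l.9–26 «Proof of
Theorem 1.1. Assume for contradiction that T* < ∞. Step 1. Lemma 3.4 extracts a running-max ancient
element with |ω^∞(0,0)| = 1 and ‖ω^∞‖_{L∞} ≤ 1. Step 2. Theorem 4.4 … Theorem 5.1 … Corollary 5.3: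
E_ω(z₀,R) ≤ C₁R⁵ + C₂R³. Step 3. Theorem 6.11 dissolves the zero-set defect. Theorem 7.5: ∇ξ ≡ 0
(direction constancy). Step 4. Lemma 8.3: b ≡ 0. Theorem 8.6: ρ ≡ 1. Corollary 8.7: ancient element is
rigid rotation. Step 5. Theorem 9.11: rigid rotation excluded by Theorem 9.9. Hence ω^∞ ≡ 0,
contradicting |ω^∞(0,0)| = 1.» Blow-up is meant in the Beale–Kato–Majda sense (Thm 3.1 p.5 l.3–8;
running-max normalisation by `‖ω(·,t)‖_{L∞}`, Def 3.2).

Two faces are typed: `ClaimedTheorem` (Thm 1.1 literal: EVERY smooth divergence-free `H¹` datum —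
WIDER than Fefferman (4), hence at least as strong as (A) on the data axis; conclusion «T* = ∞» read
as: a smooth global solution exists) and `NoBlowup` (what §10 argues, typed for the tree's Clay door:
every finite-energy classical solution from a class-(4) datum on `[0, T)` has BOUNDED VORTICITY — the
right-hand side of `ClayVariants.clayR3_regularity_iff_aprioriVorticityBound`, hence ⇔ (A):
`clayA_of_noBlowup` / `noBlowup_of_clayA` PROVED).

## Vocabulary and Δ recorded
`ρ = |ω|`, `ξ = ω/|ω|` on `{ω ≠ 0}` (p.4 l.6–8; typed with the junk value `0` on `{ω = 0}`, every Step
that mentions `ξ` or `∇ξ` is restricted to `{ρ > 0}`), `σ = Sξ·ξ = ⟪∇u ξ, ξ⟫`, backward cylinders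
`Q_r(x₀,t₀) = B_r(x₀) × (t₀ − r², t₀)` (p.4 l.3–5), `E_ω(z₀,r) = ∬_{Q_r(z₀)} ρ^{3/2}|∇ξ|²` (Def 2.5
p.4 l.90–96; typed as a lower Lebesgue integral — junk-free; `|∇ξ|` = operator norm of `fderiv`, the
paper's Frobenius norm differs by a factor ≤ √3, immaterial since all constants are ∃-quantified).
The ancient element's class `IsAE` = exactly what Lemmas 3.4–3.6 p.5 deliver and §§4–9 use: a classical
solution of the unforced system on `ℝ³ × (−∞, 0]` (tree `IsClassicalNSSolutionOn (Iic 0)`) with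
smooth slices, `|ω| ≤ 1`, `|ω(0,0)| = 1`, and `sup_x ρ(x,t) = 1` for every `t ≤ 0` (Lemma 3.6). It is
NOT required to be bounded or mild (§8's rigid rotation `½(−x₂,x₁,0)`, Cor 8.7, has unbounded velocity
and must be a member for the printed chain to make sense). «Running-max blow-up limit of u₀» (Def 3.2 /
Lemma 3.4, used by Thm 9.11) = `IsRunningMaxLimit`: limits, uniform on compact sets slice by slice, of
rescalings `λ_k u(x_k + λ_k y, t_k + λ_k² s)` with `λ_k → 0` of one finite-energy classical solution from
`u₀`. The data/solution class for the chain is the tree's Clay class `Shlygin2026.IsDatum` /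
`Shlygin2026.IsSol` (REUSED by import, C151: smooth, divergence free, rapid decay (4); classical on
`[0,T)`, finite energy) — NARROWER data than the printed `H¹`, so every universally quantified Step is
typed at most as strong as printed, and the Clay door applies verbatim.

## Architecture of the printed argument and the typed Steps (dependency order = §10's order)
* Step 1 = `Lemma34_Extraction` — Def 3.2 + Lemmas 3.3–3.6 p.5 l.9–73: BKM blow-up ⇒ a running-max
  ancient element (`IsAE`) that is a running-max limit of the solution. TRUE-type up to the class
  (compactness; the printed limit is a «suitable weak solution», smoothness from Lemma 3.5).
* (inputs of Step 2, NOT typed in rev 1: Thm 4.4 (4.2) p.6 l.21–53 «∬_{Q_r(z₀)} ρ^{3/2}|σ_near(x;r)|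
  ≤ C r⁵» and Thm 5.1/5.2 p.6 — the near/tail split `σ = σ_near(x;r) + σ_tail(x;r)` of Def 2.6 p.4
  l.98–100 is a Biot–Savart truncation at `B_r(x)` whose typing (singular integral of the strain
  kernel over a moving ball) is deferred; Remark 4.5 p.6: (4.2) «uses only ‖ω^∞‖_{L∞} ≤ 1 and
  |ξ| ≤ 1»; its printed proof is Hölder on `B_r` × the time length `r²`.)
* Step 2 = `Cor53_Coherence` — Corollary 5.3 (5.1) p.6 «E_ω(z₀, R) ≤ C₁R⁵ + C₂R³» for the ancient
  element, every `z₀` (with `t₀ ≤ 0`) and `0 < R ≤ 1` — the display §§7–10 consume.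
* Step 3 = `Theorem611_TFPinch` — Thm 6.11 p.8 l.40–50 (i)–(iii), a calculus statement about
  `F_r(η) = Σᵢ wᵢ (J(e^{η−ϑᵢ}) + J(e^{η+ϑᵢ}))`, `J(x) = ½(x + x⁻¹) − 1` (Def 6.1 p.7, Def 6.9 p.8):
  strictly convex, unique minimiser `η = 0`, `F′(0) = 0`, `F(0) = 2Σwᵢ(cosh ϑᵢ − 1) ≥ 0` with equality
  iff all `ϑᵢ = 0`. TRUE-type (cosh calculus); (iv) «the minimizer is nonsingular at the zero node» is
  not a mathematical statement and is not typed.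
* Step 4 = `Prop72_BelowStruwe` — Prop 7.2 p.9 l.16–43 «∬_{Q_δ(0,0)} |∇ξ|² ≤ E₀* ≪ 4π» with
  `δ = 1/(2C_Ser)` universal (Lemma 7.1), typed `∃ δ > 0, ∃ E₀ < 4π` (an UNNORMALISED space–time
  integral compared with the number `4π`; Thm 7.3 p.9 l.44–53 prints the ε-regularity hypothesis
  without the `r⁻³` of the paper's own (7.1) — typist's flag; Thm 7.3 itself, a lemma about the
  direction equation (2.4) with frozen coefficients, is not typed in rev 1).
* Step 5 = `Theorem74_GradBound` — Thm 7.4 p.9 l.54–64 «|∇ξ^∞(z₁)| ≤ 2C_S C_Ser/η whenever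
  ρ^∞(z₁) ≥ η» (one constant for all `η > 0`).
* Step 6 = `Step1_75_Transfer` — Thm 7.5 proof Step 1 p.9 l.69–75: «By Theorem 6.11, this defect is
  absent: the J-optimal geometric mean cancels the singular odd mode, so ξ extends smoothly across
  {ρ = 0}. Consequently there exists a universal constant C_∞ < ∞ with |∇ξ^∞| ≤ C_∞ everywhere» —
  typed on `{ρ > 0}` (the extension itself is not given a definition in print). This is the sentence
  that applies the graph/cost statement Thm 6.11 to the PDE object (LOCATORS §3: «no lemma connects
  F_r to the PDE (2.4)»).
* Step 7 = `Display74_Damping` — (7.4) p.10 l.109–124, the «RS cost-contraction mechanism ([8] …) In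
  the parabolic setting this translates to a pointwise damping inequality: at any z₀ with ρ ≥ ¼,
  w(z₀) ≤ (C_mv/r⁵)∬_{Q_r(z₀)} ρ^{3/2}|σ| + C_bdy r⁻²» (`w = |∇ξ|²`), typed for `0 < r ≤ 1`; cited to
  the author's manuscript [8], no PDE proof printed. ((7.2), (7.3), (7.5) and the «ancient steady
  state» display p.12 l.65–70 are further unproved displays of the same proof — docstring only.)
* Step 8 = `Theorem75_DirectionConstancy` — Thm 7.5 p.9 l.65–66 «∇ξ^∞ ≡ 0 on R³ × (−∞, 0]», typed on
  `{ρ > 0}`, together with the form §8 p.12 l.84–86 USES («ξ^∞ ≡ b₀ for some constant b₀ ∈ S²»):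
  `Theorem75_const`.
* Step 9 = `Theorem86_RhoOne` — Lemmas 8.1–8.4, Thm 8.5, Thm 8.6 p.12 l.87 – p.13 l.30: constant
  direction ⇒ `ρ^∞ ≡ 1`.
* Step 10 = `Cor87_RigidRotation` — Cor 8.7 p.13 l.31–38 «u^∞ = ½(−x₂, x₁, 0) + c(t)» (about the axis
  `b₀`; printed proof: «2D Biot–Savart … v = ½(−x₂,x₁) + ∇φ with Δφ = 0. Smoothness and absence of
  faster-than-linear growth force ∇φ to be at most a time-dependent constant»). Typist's flag: linear
  flows `½ b₀ × x + Mx` with `M` symmetric trace-free, `M b₀ = 0` (e.g. plane Couette `(x₂, 0, 0)` =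
  rotation + strain) have `ρ ≡ 1`, `ξ ≡ ∓e₃`, linear growth, and are classical ancient solutions.
* Step 11 = `Theorem911_NoRigidLimit` — Thm 9.11 p.14 l.28 – p.15 l.8 «The rigid rotation u_rig cannot
  arise as a running-max blow-up limit of any u₀ ∈ H¹(R³)» (typed for Clay data ⊂ H¹; any axis, any
  drift `c(t)`). Its printed proof (Steps 1–4: «finite linking budget», «infinite unlinking
  required», Thm 9.9's «C_link ≥ |ΔLk| ln φ» with `φ` the golden ratio (Def 9.6 «elementary ledger bit
  cost»), «Fredholm index −∞») uses «topological action C_link», «J-cost budget», «linking density»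
  — none defined for a Navier–Stokes solution in the text (deferred to the author's manuscripts
  [8], [10], [11]); Thm 9.9 / Def 9.6 / Lemma 9.7 are therefore not typed as Steps.

COMPOSITION (PROVED, pure logic, §10 p.15): `noBlowup_of_steps : Lemma34_Extraction →
Theorem75_const → Theorem86_RhoOne → Cor87_RigidRotation → Theorem911_NoRigidLimit → NoBlowup`
(binder order = §10's Steps 1, 3, 4, 4, 5; Steps 2–7 above are the printed SUPPORT of binder 2 and
are typed alongside so that the first failing display inside Thm 7.5's proof can be keyed);
`clayA_of_noBlowup : NoBlowup → clayR3.Regularity` and the converse PROVED; `clayA_of_steps`;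
`claimed_on_clayData_of_noBlowup` (Thm 1.1 on Clay data). `ClaimedTheorem` (H¹ data) is not reached
from `NoBlowup` in the kernel (wider data class; recorded, not a wrong-problem axis: the claim is
STRONGER than (A)).

Cell files: `claims/Washburn2026/CARD.md` (typist-7 g7; PREDICTION sealed 2026-08-27T11:57:17Z, sha16
4b5aecb8ef500330). WHAT THIS IS NOT: not a claim about NS regularity or blow-up; not a claim about
any author beyond the typed locator.
-/

noncomputable section

open MeasureTheory Set Filter Topology
open scoped ENNReal NNReal ContDiff RealInnerProductSpace

namespace Literature.Claims.NS.Washburn2026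

open Literature.Analysis Literature.Analysis.FluidPDE Literature.Claims.NS.ClayVariants
open Literature.Claims.NS.Shlygin2026 (IsDatum IsSol)

/-! ## Vocabulary -/

/-- Physical space `ℝ³`. [folklore] -/
abbrev E3 : Type := EuclideanSpace ℝ (Fin 3)

/-- `ρ = |ω|`, the vorticity magnitude of the slice `w t`. [cite: Washburn2026, §2.1 p.4 l.6] -/
def rho (w : ℝ → E3 → E3) (t : ℝ) (x : E3) : ℝ := ‖curl (w t) x‖

/-- `ξ = ω/|ω|`, the vorticity direction (junk `0` on `{ω = 0}`; Steps restrict to `{ρ > 0}`).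
[cite: Washburn2026, §2.1 p.4 l.6–8] -/
def xi (w : ℝ → E3 → E3) (t : ℝ) (x : E3) : E3 := (rho w t x)⁻¹ • curl (w t) x

/-- `∇ξ(x,t)` as a linear map (Fréchet derivative of the slice `ξ(·,t)`).
[cite: Washburn2026, §2.1 p.4; Def 2.5 p.4 l.90–96] -/
def gradXi (w : ℝ → E3 → E3) (t : ℝ) (x : E3) : E3 →L[ℝ] E3 := fderiv ℝ (xi w t) x

/-- The stretching scalar `σ = Sξ·ξ = ⟪(∇u)ξ, ξ⟫` (the antisymmetric part drops out).
[cite: Washburn2026, §2.1 p.4 l.8–14] -/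
def sigma (w : ℝ → E3 → E3) (t : ℝ) (x : E3) : ℝ := ⟪fderiv ℝ (w t) x (xi w t x), xi w t x⟫

/-- **Weighted direction coherence** `E_ω(z₀, r) = ∬_{Q_r(z₀)} ρ^{3/2}|∇ξ|²` over the backward
cylinder `Q_r(x₀,t₀) = B_r(x₀) × (t₀ − r², t₀)` (lower Lebesgue integral, junk-free).
[cite: Washburn2026, Def 2.5 p.4 l.90–96; §2.1 p.4 l.3–5] -/
def Eomega (w : ℝ → E3 → E3) (x₀ : E3) (t₀ r : ℝ) : ℝ≥0∞ :=
  ∫⁻ t in Ioo (t₀ - r ^ 2) t₀, ∫⁻ x in Metric.ball x₀ r,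
    ENNReal.ofReal (rho w t x ^ (3 / 2 : ℝ) * ‖gradXi w t x‖ ^ 2)

/-- `∬_{Q_r(z₀)} ρ^{3/2}|σ|` (right-hand side of (7.4); lower Lebesgue integral).
[cite: Washburn2026, (7.4) p.10 l.118–124] -/
def weightedStretch (w : ℝ → E3 → E3) (x₀ : E3) (t₀ r : ℝ) : ℝ≥0∞ :=
  ∫⁻ t in Ioo (t₀ - r ^ 2) t₀, ∫⁻ x in Metric.ball x₀ r,
    ENNReal.ofReal (rho w t x ^ (3 / 2 : ℝ) * |sigma w t x|)

/-- **The running-max ancient element's class** — what Lemma 3.4 + Lemma 3.5 + Lemma 3.6 p.5 deliver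
and §§4–9 use: a classical solution `(w, q)` of the unforced system on `ℝ³ × (−∞, 0]` with smooth
slices, `‖ω^∞‖_{L∞} ≤ 1`, `|ω^∞(0,0)| = 1`, and `sup_x ρ^∞(x,t) = 1` for every `t ≤ 0`. Not assumed
bounded or mild (Cor 8.7's rigid rotation must be a member).
[cite: Washburn2026, Lemma 3.4 p.5 l.38–59; Lemma 3.5 p.5 l.60–62; Lemma 3.6 p.5 l.63–73] -/
structure IsAE (ν : ℝ) (w : ℝ → E3 → E3) (q : ℝ → E3 → ℝ) : Prop where
  classical : IsClassicalNSSolutionOn (Iic 0) ν 0 w q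
  smooth : ∀ t : ℝ, t ≤ 0 → ContDiff ℝ ∞ (w t)
  vort_le : ∀ t : ℝ, t ≤ 0 → ∀ x, rho w t x ≤ 1
  origin : rho w 0 0 = 1
  sup_one : ∀ t : ℝ, t ≤ 0 → ∀ ε : ℝ, 0 < ε → ∃ x, 1 - ε < rho w t x

/-- BKM blow-up on `[0, T)` (Thm 3.1 p.5 l.3–8: «blows up at T* < ∞ only if ∫₀^{T*}‖ω‖_∞ = ∞»;
Def 3.2 uses the running max of `‖ω(·,t)‖_∞`): the vorticity is UNBOUNDED on `[0, T) × ℝ³`.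
[cite: Washburn2026, Thm 3.1 p.5 l.3–8; Def 3.2 p.5 l.9–23] -/
def BlowsUpBKM (u : ℝ → E3 → E3) (T : ℝ) : Prop :=
  ¬ ∃ M : ℝ, ∀ t ∈ Ico 0 T, ∀ x, ‖curl (u t) x‖ ≤ M

/-- **«w arises as a running-max blow-up limit of u»** (Def 3.2 (3.1) / Lemma 3.4 p.5): there are
centres `x_k`, times `t_k ∈ [0, T)` and scales `λ_k → 0⁺` such that the rescalings
`λ_k u(x_k + λ_k y, t_k + λ_k² s)` converge to `w(s, ·)` uniformly on compact sets, for every `s ≤ 0`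
(the printed convergence is `C^α_loc` on compact cylinders). [cite: Washburn2026, Def 3.2 (3.1) p.5 l.9–23; Lemma 3.4 p.5 l.38–47] -/
def IsRunningMaxLimit (u : ℝ → E3 → E3) (T : ℝ) (w : ℝ → E3 → E3) : Prop :=
  ∃ (xk : ℕ → E3) (tk lam : ℕ → ℝ), (∀ k, tk k ∈ Ico 0 T ∧ 0 < lam k) ∧
    Tendsto lam atTop (𝓝 0) ∧
    ∀ s : ℝ, s ≤ 0 → ∀ K : Set E3, IsCompact K →
      TendstoUniformlyOn (fun k y => lam k • u (tk k + lam k ^ 2 * s) (xk k + lam k • y)) (w s) atTop K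

/-- Cross product on `ℝ³`. [folklore] -/
def cross (a b : E3) : E3 :=
  WithLp.toLp 2 ![a 1 * b 2 - a 2 * b 1, a 2 * b 0 - a 0 * b 2, a 0 * b 1 - a 1 * b 0]

/-- The rigid rotation about the unit axis `b₀` with Galilean drift `c`: `½ b₀ × x + c`
(for `b₀ = e₃`: `½(−x₂, x₁, 0) + c`). [cite: Washburn2026, Cor 8.7 p.13 l.31–33] -/
def rigid (b₀ c x : E3) : E3 := (1 / 2 : ℝ) • cross b₀ x + c

/-- `J(x) = ½(x + x⁻¹) − 1`. [cite: Washburn2026, Def 6.1 p.7] -/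
def J (x : ℝ) : ℝ := (x + x⁻¹) / 2 - 1

/-- `F_r(η) = Σᵢ wᵢ (J(e^{η−ϑᵢ}) + J(e^{η+ϑᵢ}))` for a balanced opposite-pair neighbourhood with
weights `wᵢ` and log-ratios `±ϑᵢ`. [cite: Washburn2026, Def 6.9 p.8] -/
def Fpair {m : ℕ} (wt th : Fin m → ℝ) (η : ℝ) : ℝ :=
  ∑ i, wt i * (J (Real.exp (η - th i)) + J (Real.exp (η + th i)))

/-! ## The claimed statement -/

/-- **CLAIMED THEOREM = Thm 1.1 p.3 l.2–7, literal**: for every `ν > 0` and every smooth,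
divergence-free `u₀ ∈ H¹(ℝ³)` (`u₀`, `∇u₀ ∈ L²`), the smooth solution is global («T* = ∞»): a smooth
solution `(u, p)` of the unforced system on `ℝ³ × [0, ∞)` with `u(0) = u₀` exists. Data WIDER than
Fefferman (4). [claim: Washburn2026, status: under-review] [cite: Washburn2026, Thm 1.1 p.3 l.2–7; (1.1) p.2 l.28–49] -/
def ClaimedTheorem : Prop :=
  ∀ ν : ℝ, 0 < ν → ∀ u₀ : E3 → E3, ContDiff ℝ ∞ u₀ → NSWave0.IsDivFree u₀ →
    MemLp u₀ 2 volume → MemLp (fun x => fderiv ℝ u₀ x) 2 volume →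
    ∃ (u : ℝ → E3 → E3) (p : ℝ → E3 → ℝ),
      IsSmoothOnHalfSpace u ∧ IsSmoothOnHalfSpace p ∧ IsNavierStokesSolution ν 0 u₀ u p

/-- **What §10 argues (p.15 l.9–26 with Thm 3.1 p.5): NO BKM BLOW-UP** — every finite-energy classical
solution from a Clay datum on a slab `[0, T)` has bounded vorticity there. This is the right-hand
side of the tree's door `clayR3_regularity_iff_aprioriVorticityBound`, i.e. ⇔ Clay (A).
[claim: Washburn2026, status: under-review] [cite: Washburn2026, §10 p.15 l.9–26; Thm 3.1 p.5 l.3–8] -/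
def NoBlowup : Prop :=
  ∀ ν : ℝ, 0 < ν → ∀ (u₀ : E3 → E3) (T : ℝ) (u : ℝ → E3 → E3) (p : ℝ → E3 → ℝ),
    IsSol ν u₀ T u p → ¬ BlowsUpBKM u T

/-! ## The Steps of the printed argument -/

/-- **Step 1 — Lemma 3.4 (with Def 3.2, Lemmas 3.3, 3.5, 3.6) p.5 l.9–73**: if the solution blows up
(BKM) on `[0, T)`, a subsequence of running-max rescalings converges to an ancient element of the
class `IsAE` («suitable weak solution (u^∞, p^∞) on R³ × (−∞, 0] with |ω^∞(0, 0)| = 1 and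
‖ω^∞‖_{L∞} ≤ 1», smooth by Lemma 3.5, `sup_x ρ = 1` by Lemma 3.6). TRUE-type up to the class.
[claim: Washburn2026, status: under-review] [cite: Washburn2026, Def 3.2, Lemmas 3.3–3.6 p.5 l.9–73] -/
def Lemma34_Extraction : Prop :=
  ∀ ν : ℝ, 0 < ν → ∀ (u₀ : E3 → E3) (T : ℝ) (u : ℝ → E3 → E3) (p : ℝ → E3 → ℝ),
    IsSol ν u₀ T u p → BlowsUpBKM u T →
      ∃ (w : ℝ → E3 → E3) (q : ℝ → E3 → ℝ), IsAE ν w q ∧ IsRunningMaxLimit u T w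

/-- **Step 2 — Corollary 5.3 (Global coherence estimate) (5.1) p.6**: «For the ancient element and
0 < R ≤ 1, E_ω(z₀, R) ≤ C₁R⁵ + C₂R³» (every centre `z₀ = (x₀, t₀)`, `t₀ ≤ 0`; constants universal —
typed per viscosity, `∃` outside the element). Printed inputs: Thm 4.4 (4.2), Thm 5.1, Thm 5.2,
Lemma 2.4 (not typed, see module docstring). [claim: Washburn2026, status: under-review] [cite: Washburn2026, Cor 5.3 (5.1) p.6 l.110–119; Thm 4.4 (4.2) p.6 l.21–53] -/
def Cor53_Coherence : Prop :=
  ∀ ν : ℝ, 0 < ν → ∃ C₁ C₂ : ℝ, 0 ≤ C₁ ∧ 0 ≤ C₂ ∧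
    ∀ (w : ℝ → E3 → E3) (q : ℝ → E3 → ℝ), IsAE ν w q →
      ∀ (x₀ : E3) (t₀ : ℝ), t₀ ≤ 0 → ∀ R : ℝ, 0 < R → R ≤ 1 →
        Eomega w x₀ t₀ R ≤ ENNReal.ofReal (C₁ * R ^ 5 + C₂ * R ^ 3)

/-- **Step 3 — Theorem 6.11 (Topological Frustration Pinch at a zero node) p.8 l.40–50, (i)–(iii)**:
in a balanced opposite-pair neighbourhood (weights `wᵢ > 0`, log-ratios `±ϑᵢ`, Def 6.9): (i) `F_r` is
strictly convex with unique minimiser `η* = 0`; (ii) `F′_r(0) = 0`; (iii) `F_r(0) = 2Σᵢwᵢ(cosh ϑᵢ − 1)`,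
`> 0` unless all `ϑᵢ = 0`. TRUE-type calculus; (iv) not a mathematical statement.
[claim: Washburn2026, status: under-review] [cite: Washburn2026, Thm 6.11 p.8 l.40–84; Def 6.1 p.7; Def 6.9 p.8] -/
def Theorem611_TFPinch : Prop :=
  ∀ (m : ℕ) (wt th : Fin m → ℝ), 0 < m → (∀ i, 0 < wt i) →
    StrictConvexOn ℝ univ (Fpair wt th) ∧ (∀ η : ℝ, η ≠ 0 → Fpair wt th 0 < Fpair wt th η) ∧
    deriv (Fpair wt th) 0 = 0 ∧
    Fpair wt th 0 = 2 * ∑ i, wt i * (Real.cosh (th i) - 1) ∧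
    (Fpair wt th 0 = 0 ↔ ∀ i, th i = 0)

/-- **Step 4 — Proposition 7.2 (Direction energy below Struwe threshold) p.9 l.16–43** «∬_{Q_δ(0,0)}
|∇ξ|² ≤ E₀* ≪ 4π» with the universal `δ = 1/(2C_Ser)` of Lemma 7.1 (on `Q_δ`, `ρ ≥ ½`): typed as
`∃ δ > 0, ∃ E₀ < 4π`, the unnormalised integral over `Q_δ(0,0) ∩ {ρ > 0}`.
[claim: Washburn2026, status: under-review] [cite: Washburn2026, Lemma 7.1, Prop 7.2 p.9 l.3–43] -/
def Prop72_BelowStruwe : Prop :=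
  ∀ ν : ℝ, 0 < ν → ∃ δ E₀ : ℝ, 0 < δ ∧ E₀ < 4 * Real.pi ∧
    ∀ (w : ℝ → E3 → E3) (q : ℝ → E3 → ℝ), IsAE ν w q →
      (∫⁻ t in Ioo (-(δ ^ 2)) 0, ∫⁻ x in Metric.ball (0 : E3) δ,
          ENNReal.ofReal (if 0 < rho w t x then ‖gradXi w t x‖ ^ 2 else 0)) ≤ ENNReal.ofReal E₀

/-- **Step 5 — Theorem 7.4 p.9 l.54–64** «For every η > 0, |∇ξ^∞(z₁)| ≤ 2C_S C_Ser/η whenever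
ρ^∞(z₁) ≥ η» (one constant, all `η`). [claim: Washburn2026, status: under-review] [cite: Washburn2026, Thm 7.4 p.9 l.54–64; Thm 7.3 p.9 l.44–53] -/
def Theorem74_GradBound : Prop :=
  ∀ ν : ℝ, 0 < ν → ∃ C : ℝ, ∀ (w : ℝ → E3 → E3) (q : ℝ → E3 → ℝ), IsAE ν w q →
    ∀ η : ℝ, 0 < η → ∀ t : ℝ, t ≤ 0 → ∀ x, η ≤ rho w t x → ‖gradXi w t x‖ ≤ C / η

/-- **Step 6 — Theorem 7.5, proof Step 1 p.9 l.69–75 (the transfer of Thm 6.11 to the PDE)**: «By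
Theorem 6.11, this defect is absent … ξ extends smoothly across {ρ = 0}. Consequently there exists
a universal constant C_∞ < ∞ with |∇ξ^∞| ≤ C_∞ everywhere on R³ × (−∞, 0]» — typed on `{ρ > 0}`.
[claim: Washburn2026, status: under-review] [cite: Washburn2026, Thm 7.5 proof Step 1 p.9 l.69–75] -/
def Step1_75_Transfer : Prop :=
  ∀ ν : ℝ, 0 < ν → ∃ C : ℝ, ∀ (w : ℝ → E3 → E3) (q : ℝ → E3 → ℝ), IsAE ν w q →
    ∀ t : ℝ, t ≤ 0 → ∀ x, 0 < rho w t x → ‖gradXi w t x‖ ≤ C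

/-- **Step 7 — display (7.4) p.10 l.109–124** («RS cost-contraction mechanism ([8] …) … pointwise
damping inequality»): at any `z₀ = (x₀, t₀)` with `ρ ≥ ¼`, for `0 < r ≤ 1`,
`|∇ξ(z₀)|² ≤ (C_mv/r⁵) ∬_{Q_r(z₀)} ρ^{3/2}|σ| + C_bdy r⁻²`.
[claim: Washburn2026, status: under-review] [cite: Washburn2026, (7.4) p.10 l.109–124] -/
def Display74_Damping : Prop :=
  ∀ ν : ℝ, 0 < ν → ∃ Cmv Cbdy : ℝ, ∀ (w : ℝ → E3 → E3) (q : ℝ → E3 → ℝ), IsAE ν w q →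
    ∀ (x₀ : E3) (t₀ : ℝ), t₀ ≤ 0 → (1 / 4 : ℝ) ≤ rho w t₀ x₀ → ∀ r : ℝ, 0 < r → r ≤ 1 →
      ENNReal.ofReal (‖gradXi w t₀ x₀‖ ^ 2) ≤
        ENNReal.ofReal (Cmv / r ^ 5) * weightedStretch w x₀ t₀ r + ENNReal.ofReal (Cbdy / r ^ 2)

/-- **Step 8 — Theorem 7.5 (Direction constancy) p.9 l.65–66** «∇ξ^∞ ≡ 0 on R³ × (−∞, 0]», on
`{ρ > 0}`. [claim: Washburn2026, status: under-review] [cite: Washburn2026, Thm 7.5 p.9 l.65 – p.12 l.82] -/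
def Theorem75_DirectionConstancy : Prop :=
  ∀ ν : ℝ, 0 < ν → ∀ (w : ℝ → E3 → E3) (q : ℝ → E3 → ℝ), IsAE ν w q →
    ∀ t : ℝ, t ≤ 0 → ∀ x, 0 < rho w t x → gradXi w t x = 0

/-- **Step 8, as §8 uses it (p.12 l.84–86)** «we assume the conclusion of Theorem 7.5: ξ^∞ ≡ b₀ for
some constant b₀ ∈ S²»: one unit vector `b₀` with `ξ = b₀` on `{ρ > 0}`.
[claim: Washburn2026, status: under-review] [cite: Washburn2026, §8 p.12 l.84–86; Thm 7.5 p.9 l.65–66] -/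
def Theorem75_const : Prop :=
  ∀ ν : ℝ, 0 < ν → ∀ (w : ℝ → E3 → E3) (q : ℝ → E3 → ℝ), IsAE ν w q →
    ∃ b₀ : E3, ‖b₀‖ = 1 ∧ ∀ t : ℝ, t ≤ 0 → ∀ x, 0 < rho w t x → xi w t x = b₀

/-- **Step 9 — Theorem 8.6 p.13 l.23–30 (via Lemmas 8.1–8.4, Thm 8.5)** «ρ^∞ ≡ 1 on R² × (−∞, 0]»:
constant direction ⇒ unit vorticity magnitude everywhere.
[claim: Washburn2026, status: under-review] [cite: Washburn2026, Lemma 8.1 – Thm 8.6 p.12 l.87 – p.13 l.30] -/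
def Theorem86_RhoOne : Prop :=
  ∀ ν : ℝ, 0 < ν → ∀ (w : ℝ → E3 → E3) (q : ℝ → E3 → ℝ), IsAE ν w q →
    ∀ b₀ : E3, ‖b₀‖ = 1 → (∀ t : ℝ, t ≤ 0 → ∀ x, 0 < rho w t x → xi w t x = b₀) →
      ∀ t : ℝ, t ≤ 0 → ∀ x, rho w t x = 1

/-- **Step 10 — Corollary 8.7 p.13 l.31–38** «(Ancient element is rigid rotation). u^∞ = ½(−x₂, x₁, 0)
+ c(t), where c(t) is a Galilean drift» (about the constant axis `b₀`).
[claim: Washburn2026, status: under-review] [cite: Washburn2026, Cor 8.7 p.13 l.31–38] -/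
def Cor87_RigidRotation : Prop :=
  ∀ ν : ℝ, 0 < ν → ∀ (w : ℝ → E3 → E3) (q : ℝ → E3 → ℝ), IsAE ν w q →
    ∀ b₀ : E3, ‖b₀‖ = 1 → (∀ t : ℝ, t ≤ 0 → ∀ x, 0 < rho w t x → xi w t x = b₀) →
      (∀ t : ℝ, t ≤ 0 → ∀ x, rho w t x = 1) →
        ∃ c : ℝ → E3, ∀ t : ℝ, t ≤ 0 → ∀ x, w t x = rigid b₀ (c t) x

/-- **Step 11 — Theorem 9.11 p.14 l.28 – p.15 l.8** «The rigid rotation u_rig cannot arise as a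
running-max blow-up limit of any u₀ ∈ H¹(R³)» — typed for Clay data (⊂ H¹), any axis and drift.
[claim: Washburn2026, status: under-review] [cite: Washburn2026, Thm 9.11 p.14 l.28 – p.15 l.8; Thm 9.9 p.14 l.17–24] -/
def Theorem911_NoRigidLimit : Prop :=
  ∀ ν : ℝ, 0 < ν → ∀ (u₀ : E3 → E3) (T : ℝ) (u : ℝ → E3 → E3) (p : ℝ → E3 → ℝ),
    IsSol ν u₀ T u p → ∀ w : ℝ → E3 → E3, IsRunningMaxLimit u T w →
      ∀ (b₀ : E3) (c : ℝ → E3), ‖b₀‖ = 1 → ¬ ∀ t : ℝ, t ≤ 0 → ∀ x, w t x = rigid b₀ (c t) x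

/-! ## Kernel relations -/

-- Note (records): the §8 form `Theorem75_const` follows from the literal `Theorem75_DirectionConstancy`
-- only with a connectedness/choice argument the text does not print; neither direction is claimed in
-- the kernel. The literal face is the referee's comparison object; the composition consumes the §8 form.

/-- **COMPOSITION OF §10 (PROVED)** — «Assume for contradiction that T* < ∞» (BKM blow-up on a slab):
Step 1 extracts an ancient element that is a running-max limit; Thm 7.5 (§8 form) gives a constant
direction `b₀`; Thm 8.6 gives `ρ ≡ 1`; Cor 8.7 makes the element the rigid rotation about `b₀`;
Thm 9.11 forbids that for a running-max limit — contradiction. [cite: Washburn2026, §10 p.15 l.9–26] -/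
theorem noBlowup_of_steps (h34 : Lemma34_Extraction) (h75 : Theorem75_const) (h86 : Theorem86_RhoOne)
    (h87 : Cor87_RigidRotation) (h911 : Theorem911_NoRigidLimit) : NoBlowup := by
  intro ν hν u₀ T u p hs hb
  obtain ⟨w, q, hw, hlim⟩ := h34 ν hν u₀ T u p hs hb
  obtain ⟨b₀, hb₀, hξ⟩ := h75 ν hν w q hw
  have hρ := h86 ν hν w q hw b₀ hb₀ hξ
  obtain ⟨c, hc⟩ := h87 ν hν w q hw b₀ hb₀ hξ hρ
  exact h911 ν hν u₀ T u p hs w hlim b₀ c hb₀ hc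

/-- **NO BLOW-UP ⇒ Clay (A)** — the a priori vorticity bound for the class IS the hypothesis of the
tree's door `clayR3_regularity_iff_aprioriVorticityBound` (Beale–Kato–Majda + blow-up alternative).
[cite: Washburn2026, §10 p.15] [cite: BealeKatoMajda1984, Thm. 1] [cite: FeffermanClay2006, (A) p.2] -/
theorem clayA_of_noBlowup (h : NoBlowup) : clayR3.Regularity :=
  clayR3_regularity_iff_aprioriVorticityBound.2 fun ν hν u₀ hsm hdiv hdec T u p hcl hu0 hE => by
    have h' := h ν hν u₀ T u p ⟨⟨hsm, hdiv, hdec⟩, hcl, hu0, hE⟩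
    unfold BlowsUpBKM at h'
    push Not at h'
    exact h'

/-- Conversely Clay (A) gives the a priori bound, so `NoBlowup` is EXACTLY summit-strength.
[cite: FeffermanClay2006, (A) p.2] -/
theorem noBlowup_of_clayA (h : clayR3.Regularity) : NoBlowup := by
  intro ν hν u₀ T u p hs hb
  exact hb (clayR3_regularity_iff_aprioriVorticityBound.1 h ν hν u₀ hs.datum.1 hs.datum.2.1
    hs.datum.2.2 T u p hs.classical hs.initial hs.energy)

/-- The chain to Clay (A). [cite: Washburn2026, §10 p.15 l.9–26] -/
theorem clayA_of_steps (h34 : Lemma34_Extraction) (h75 : Theorem75_const) (h86 : Theorem86_RhoOne)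
    (h87 : Cor87_RigidRotation) (h911 : Theorem911_NoRigidLimit) : clayR3.Regularity :=
  clayA_of_noBlowup (noBlowup_of_steps h34 h75 h86 h87 h911)

/-- Thm 1.1 restricted to Clay data follows from `NoBlowup` (the Clay solution is a smooth global
solution). [cite: Washburn2026, Thm 1.1 p.3 l.2–7] -/
theorem claimed_on_clayData_of_noBlowup (h : NoBlowup) :
    ∀ ν : ℝ, 0 < ν → ∀ u₀ : E3 → E3, IsDatum u₀ →
      ∃ (u : ℝ → E3 → E3) (p : ℝ → E3 → ℝ),
        IsSmoothOnHalfSpace u ∧ IsSmoothOnHalfSpace p ∧ IsNavierStokesSolution ν 0 u₀ u p := by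
  intro ν hν u₀ hu₀
  obtain ⟨u, p, hu, hp, hns, -⟩ := clayA_of_noBlowup h ν hν u₀ hu₀.1 hu₀.2.1 hu₀.2.2
  exact ⟨u, p, hu, hp, hns⟩

/-! ## Rev 2 (typist-7 g7, D-0026 append-only; rev-1 statements untouched): the referee's charitable
class (C1) and class forms (C3), pasted from `HOME/ns-claims-ref-3/retype-Washburn2026.ref3g7.lean`
(REF-3 g7 RETYPE v1 2026-08-27T12:38Z, sha16 dad8795f6790575c; name map: `Cor53_Coherence'` ↦
`Cor53_Coherence_bdd`, `Theorem75_const'` ↦ `Theorem75_const_bdd`, `Cor53_Coherence''` ↦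
`Cor53_Coherence_perElement`; `IsAEBounded`, `Lemma71_UniversalBall`, `Lemma35_SerrinGrad` verbatim),
plus the bounded-class extraction `Lemma34_Extraction_bdd` and the bounded composition
`noBlowup_of_steps_bdd`. Context (REF-3 v1 F6): the typed class `IsAE` — exactly what Lemmas 3.4–3.6
print — admits exact steady members with non-constant vorticity direction (tilted Burgers shear layers
`u = (−γx₁, γx₂ + a x₁, W(x₁))`, `W′ = b e^{−γx₁²/(2ν)}`, `a² + b² = 1`) and plane Couette, so Steps
2, 4–8 and 10 are decided on the class as typed; the velocity bound the print ASSERTS inside the proofs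
of Lemma 3.4 (p.5 l.48–49 «Uniform local energy bounds follow from ‖ω^(k)‖_{L∞} ≤ 2 and the
Biot–Savart law») and Lemma 3.5 (p.5 l.62 «Bounded vorticity implies locally bounded velocity via
Biot–Savart») is the charitable reading, under which the extraction step itself carries the load. -/

/-- **(C1) the charitable class**: an ancient element of `IsAE` with velocity bounded by `V` on
`ℝ³ × (−∞, 0]` (the control asserted in the proofs of Lemma 3.4 p.5 l.48–49 and Lemma 3.5 p.5 l.62,
read as a property of the element). Excludes the tilted layers, Couette and the paper's own rigid
rotation (Cor 8.7). [cite: Washburn2026, Lemma 3.4 proof p.5 l.48–49; Lemma 3.5 proof p.5 l.62] -/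
def IsAEBounded (ν V : ℝ) (w : ℝ → E3 → E3) (q : ℝ → E3 → ℝ) : Prop :=
  IsAE ν w q ∧ ∀ t : ℝ, t ≤ 0 → ∀ x, ‖w t x‖ ≤ V

/-- **Step 1 over the bounded class** — Lemma 3.4 p.5 l.38–59 read WITH its proof's first sentence
(l.48–49) as part of the conclusion: the extracted running-max limit is an ancient element with
BOUNDED velocity. [claim: Washburn2026, status: under-review] [cite: Washburn2026, Lemma 3.4 p.5 l.38–59] -/
def Lemma34_Extraction_bdd : Prop :=
  ∀ ν : ℝ, 0 < ν → ∀ (u₀ : E3 → E3) (T : ℝ) (u : ℝ → E3 → E3) (p : ℝ → E3 → ℝ),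
    IsSol ν u₀ T u p → BlowsUpBKM u T →
      ∃ (V : ℝ) (w : ℝ → E3 → E3) (q : ℝ → E3 → ℝ), IsAEBounded ν V w q ∧ IsRunningMaxLimit u T w

/-- **Step 2 over the bounded class** (REF-3 (C1) `Cor53_Coherence'`): Cor 5.3 (5.1) p.6 l.113–119 with
constants per `(ν, V)`. TRUE-type (referee's flag). [claim: Washburn2026, status: under-review] [cite: Washburn2026, Cor 5.3 (5.1) p.6 l.110–119] -/
def Cor53_Coherence_bdd : Prop :=
  ∀ ν V : ℝ, 0 < ν → ∃ C₁ C₂ : ℝ, 0 ≤ C₁ ∧ 0 ≤ C₂ ∧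
    ∀ (w : ℝ → E3 → E3) (q : ℝ → E3 → ℝ), IsAEBounded ν V w q →
      ∀ (x₀ : E3) (t₀ : ℝ), t₀ ≤ 0 → ∀ R : ℝ, 0 < R → R ≤ 1 →
        Eomega w x₀ t₀ R ≤ ENNReal.ofReal (C₁ * R ^ 5 + C₂ * R ^ 3)

/-- **Step 2, per-element constants** (REF-3 (C2) `Cor53_Coherence''`; recorded, not preferred —
Prop 7.2 needs absolute numbers). [claim: Washburn2026, status: under-review] [cite: Washburn2026, Cor 5.3 (5.1) p.6 l.110–119] -/
def Cor53_Coherence_perElement : Prop :=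
  ∀ ν : ℝ, 0 < ν → ∀ (w : ℝ → E3 → E3) (q : ℝ → E3 → ℝ), IsAE ν w q →
    ∃ C₁ C₂ : ℝ, 0 ≤ C₁ ∧ 0 ≤ C₂ ∧
      ∀ (x₀ : E3) (t₀ : ℝ), t₀ ≤ 0 → ∀ R : ℝ, 0 < R → R ≤ 1 →
        Eomega w x₀ t₀ R ≤ ENNReal.ofReal (C₁ * R ^ 5 + C₂ * R ^ 3)

/-- **Step 8 (§8 form) over the bounded class** (REF-3 (C1) `Theorem75_const'`): open-strength
(Liouville territory). [claim: Washburn2026, status: under-review] [cite: Washburn2026, Thm 7.5 p.9 l.65–66; §8 p.12 l.84–86] -/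
def Theorem75_const_bdd : Prop :=
  ∀ ν V : ℝ, 0 < ν → ∀ (w : ℝ → E3 → E3) (q : ℝ → E3 → ℝ), IsAEBounded ν V w q →
    ∃ b₀ : E3, ‖b₀‖ = 1 ∧ ∀ t : ℝ, t ≤ 0 → ∀ x, 0 < rho w t x → xi w t x = b₀

/-- **Lemma 7.1 p.9 l.3–15** (REF-3 (C3)): a universal `δ = 1/(2C_Ser)` with `ρ ≥ ½` on `Q_δ(0,0)`.
[claim: Washburn2026, status: under-review] [cite: Washburn2026, Lemma 7.1 p.9 l.3–15] -/
def Lemma71_UniversalBall : Prop :=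
  ∀ ν : ℝ, 0 < ν → ∃ δ : ℝ, 0 < δ ∧
    ∀ (w : ℝ → E3 → E3) (q : ℝ → E3 → ℝ), IsAE ν w q →
      ∀ t ∈ Ioc (-(δ ^ 2)) 0, ∀ x ∈ Metric.ball (0 : E3) δ, (1 / 2 : ℝ) ≤ rho w t x

/-- **Lemma 3.5 p.5 l.60–62, quantitative conclusion** (REF-3 (C3) = REF-1's `Lemma35_SerrinUniversal`):
«‖∇ω‖_{L∞(Q_{1/2})} ≤ C_Ser» universal, for the class. [claim: Washburn2026, status: under-review] [cite: Washburn2026, Lemma 3.5 p.5 l.60–62] -/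
def Lemma35_SerrinGrad : Prop :=
  ∀ ν : ℝ, 0 < ν → ∃ C : ℝ,
    ∀ (w : ℝ → E3 → E3) (q : ℝ → E3 → ℝ), IsAE ν w q →
      ∀ t : ℝ, t ≤ 0 → ∀ x, ‖fderiv ℝ (curl (w t)) x‖ ≤ C

/-! ### Kernel relations for the bounded faces -/

/-- The bounded extraction implies the typed one. [cite: Washburn2026, Lemma 3.4 p.5] -/
theorem lemma34_of_bdd (h : Lemma34_Extraction_bdd) : Lemma34_Extraction := by
  intro ν hν u₀ T u p hs hb
  obtain ⟨V, w, q, hw, hlim⟩ := h ν hν u₀ T u p hs hb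
  exact ⟨w, q, hw.1, hlim⟩

/-- The typed Step 2 implies its bounded-class face. [cite: Washburn2026, Cor 5.3 p.6] -/
theorem cor53_bdd_of (h : Cor53_Coherence) : Cor53_Coherence_bdd := by
  intro ν V hν
  obtain ⟨C₁, C₂, h1, h2, hC⟩ := h ν hν
  exact ⟨C₁, C₂, h1, h2, fun w q hw => hC w q hw.1⟩

/-- The typed Step 2 implies the per-element face. [cite: Washburn2026, Cor 5.3 p.6] -/
theorem cor53_perElement_of (h : Cor53_Coherence) : Cor53_Coherence_perElement := by
  intro ν hν w q hw
  obtain ⟨C₁, C₂, h1, h2, hC⟩ := h ν hν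
  exact ⟨C₁, C₂, h1, h2, hC w q hw⟩

/-- The typed §8 form of Thm 7.5 implies its bounded-class face. [cite: Washburn2026, Thm 7.5 p.9] -/
theorem theorem75_const_bdd_of (h : Theorem75_const) : Theorem75_const_bdd :=
  fun ν _ hν w q hw => h ν hν w q hw.1

/-- **COMPOSITION OVER THE CHARITABLE CLASS (PROVED)**: with the bounded extraction and the bounded §8
form of Thm 7.5, the remaining binders (Steps 9–11 as typed) close §10 exactly as before.
[cite: Washburn2026, §10 p.15 l.9–26] -/
theorem noBlowup_of_steps_bdd (h34 : Lemma34_Extraction_bdd) (h75 : Theorem75_const_bdd)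
    (h86 : Theorem86_RhoOne) (h87 : Cor87_RigidRotation) (h911 : Theorem911_NoRigidLimit) :
    NoBlowup := by
  intro ν hν u₀ T u p hs hb
  obtain ⟨V, w, q, hw, hlim⟩ := h34 ν hν u₀ T u p hs hb
  obtain ⟨b₀, hb₀, hξ⟩ := h75 ν V hν w q hw
  have hρ := h86 ν hν w q hw.1 b₀ hb₀ hξ
  obtain ⟨c, hc⟩ := h87 ν hν w q hw.1 b₀ hb₀ hξ hρ
  exact h911 ν hν u₀ T u p hs w hlim b₀ c hb₀ hc

/-- … and hence Clay (A) over the charitable class. [cite: Washburn2026, §10 p.15] -/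
theorem clayA_of_steps_bdd (h34 : Lemma34_Extraction_bdd) (h75 : Theorem75_const_bdd)
    (h86 : Theorem86_RhoOne) (h87 : Cor87_RigidRotation) (h911 : Theorem911_NoRigidLimit) :
    clayR3.Regularity :=
  clayA_of_noBlowup (noBlowup_of_steps_bdd h34 h75 h86 h87 h911)

/-! ## §K Kernel discharge of Step 3 (Theorem 6.11 (i)–(iii)) — rev 2, custodian typist-7 g8, append-only

Records-grade TRUE column of ADJUDICATED #148 (head `Theorem75_const`, untouched): the pair functional's
`cosh` calculus, no Navier–Stokes content.  Rev-1 declarations above are byte-identical. -/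

section Step3Discharge

/-- `J(e^s) = cosh s − 1`. [folklore] -/
private theorem J_exp (s : ℝ) : J (Real.exp s) = Real.cosh s - 1 := by
  unfold J
  rw [Real.cosh_eq, ← Real.exp_neg]

/-- Closed form of the pair functional: `F(η) = 2 (Σ wᵢ cosh ϑᵢ) cosh η − 2 Σ wᵢ`. [folklore] -/
private theorem Fpair_eq {m : ℕ} (wt th : Fin m → ℝ) (η : ℝ) :
    Fpair wt th η = 2 * (∑ i, wt i * Real.cosh (th i)) * Real.cosh η - 2 * ∑ i, wt i := by
  have hterm : ∀ i, wt i * (J (Real.exp (η - th i)) + J (Real.exp (η + th i))) =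
      2 * (wt i * Real.cosh (th i)) * Real.cosh η - 2 * wt i := by
    intro i
    rw [J_exp, J_exp, Real.cosh_sub, Real.cosh_add]
    ring
  unfold Fpair
  rw [Finset.sum_congr rfl (fun i _ => hterm i), Finset.sum_sub_distrib, ← Finset.sum_mul,
    ← Finset.mul_sum, ← Finset.mul_sum]

/-- **Step 3 (Theorem 6.11 (i)–(iii)) HOLDS** — elementary `cosh` calculus on the closed form
`F(η) = 2 (Σ wᵢ cosh ϑᵢ) cosh η − 2 Σ wᵢ`: strict convexity (`cosh'' = cosh > 0`), the strict minimum at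
`η = 0` (`cosh η > 1` for `η ≠ 0`), `F′(0) = 0` (`sinh 0 = 0`), the value `F(0) = 2 Σ wᵢ (cosh ϑᵢ − 1)` and its
vanishing iff all `ϑᵢ = 0` (`cosh ϑ = 1 ↔ ϑ = 0`, weights positive). Moves the docstring's «TRUE-type calculus»
to the in-file column; no Navier–Stokes content. [cite: Washburn2026, Thm 6.11 (i)–(iii) p.8 l.40–84; Def 6.1 p.7; Def 6.9 p.8] -/
theorem theorem611_TFPinch_holds : Theorem611_TFPinch := by
  intro m wt th hm hw
  haveI : Nonempty (Fin m) := ⟨⟨0, hm⟩⟩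
  set S : ℝ := ∑ i, wt i * Real.cosh (th i) with hS_def
  set W : ℝ := ∑ i, wt i with hW_def
  have hS : 0 < S :=
    Finset.sum_pos (fun i _ => mul_pos (hw i) (Real.cosh_pos _)) Finset.univ_nonempty
  have hF : Fpair wt th = fun η => 2 * S * Real.cosh η - 2 * W := funext fun η => Fpair_eq wt th η
  have hF0 : Fpair wt th 0 = 2 * ∑ i, wt i * (Real.cosh (th i) - 1) := by
    rw [Fpair_eq, Real.cosh_zero, mul_one, Finset.mul_sum, Finset.mul_sum, Finset.mul_sum,
      ← Finset.sum_sub_distrib]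
    refine Finset.sum_congr rfl fun i _ => ?_
    ring
  refine ⟨?_, ?_, ?_, hF0, ?_⟩
  · -- (i) strict convexity: second-derivative test on the closed form (`F'' = 2 S cosh > 0`)
    rw [hF]
    have hg1 : deriv (fun η => 2 * S * Real.cosh η - 2 * W) = fun η => 2 * S * Real.sinh η := by
      funext η
      exact (((Real.hasDerivAt_cosh η).const_mul (2 * S)).sub_const (2 * W)).deriv
    have hg2 : deriv (fun η => 2 * S * Real.sinh η) = fun η => 2 * S * Real.cosh η := by
      funext η
      exact ((Real.hasDerivAt_sinh η).const_mul (2 * S)).deriv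
    refine strictConvexOn_univ_of_deriv2_pos (by fun_prop) fun x => ?_
    simp only [Function.iterate_succ, Function.iterate_zero, Function.comp_apply, Function.id_def]
    rw [hg1, hg2]
    exact mul_pos (mul_pos two_pos hS) (Real.cosh_pos x)
  · -- unique strict minimum at 0
    intro η hη
    rw [hF]
    simp only [Real.cosh_zero]
    have hc : 1 < Real.cosh η := Real.one_lt_cosh.2 hη
    nlinarith
  · -- (ii) F'(0) = 0
    rw [hF]
    have hd : HasDerivAt (fun η => 2 * S * Real.cosh η - 2 * W) (2 * S * Real.sinh 0) 0 :=
      ((Real.hasDerivAt_cosh 0).const_mul (2 * S)).sub_const (2 * W)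
    rw [hd.deriv, Real.sinh_zero, mul_zero]
  · -- (iii) F(0) = 0 iff all log-ratios vanish
    rw [hF0]
    have hnn : ∀ i ∈ (Finset.univ : Finset (Fin m)), 0 ≤ wt i * (Real.cosh (th i) - 1) :=
      fun i _ => mul_nonneg (hw i).le (by linarith [Real.one_le_cosh (th i)])
    constructor
    · intro h i
      have h0 : ∑ i, wt i * (Real.cosh (th i) - 1) = 0 := by linarith
      have hi := (Finset.sum_eq_zero_iff_of_nonneg hnn).1 h0 i (Finset.mem_univ i)
      rcases mul_eq_zero.1 hi with h1 | h1
      · exact absurd h1 (hw i).ne'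
      · by_contra hne
        have := Real.one_lt_cosh.2 hne
        linarith
    · intro h
      simp [h]

end Step3Discharge

end Literature.Claims.NS.Washburn2026

end

-- WHAT THIS IS NOT: not a claim about NS regularity or blow-up; not a claim about any author beyond the
-- typed locator.
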